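import Literature.AlgebraicGeometry.Motives.Varieties
import HarnessLib

/-!
# Discharged fact: smooth projective varieties are proper over `k` (Hartshorne II.4.9)

`Literature.AlgebraicGeometry.Motives.Varieties` records as a named fact
(`Literature.IsSmoothProjective.isProper : Prop`) that the structure morphism `X → Spec k` of a smooth
projective variety `X` over a field `k` is proper. This file proves it
(`Literature.AlgebraicGeometry.Motives.IsSmoothProjective.isProper_holds`), so users holding `(h : IsSmoothProjective.isProper)` can
discharge the hypothesis. Only the field `IsSmoothProjective.isProjectiveOver` (a closed `k`-immersion
`X ↪ ℙᴺ_k`) is used: the general statement is `Literature.AlgebraicGeometry.Motives.IsProjectiveOver.isProper`.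

## Proof

This is Hartshorne, *Algebraic Geometry*, II Thm. 4.9 ("A projective morphism of noetherian schemes
is proper", p. 103) in the case of a closed subscheme of `ℙᴺ_k`, following the printed reduction
("taking into account (4.6) and (4.8) it will be sufficient to show that `ℙⁿ` is proper"):

* the structure morphism factors as `X ↪ ℙᴺ_k → Spec (𝒜 0) → Spec k`, where
  `𝒜 = MvPolynomial.homogeneousSubmodule (Fin (N+1)) k` is the grading of `k[x₀, …, x_N]` and
  `ℙᴺ_k → Spec (𝒜 0) → Spec k` is literally the structure map of `Literature.projectiveSpace N k`;
* a closed immersion is proper (II Cor. 4.8(a); Mathlib: closed immersion ⇒ finite ⇒ proper);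
* `Proj 𝒜 → Spec (𝒜 0)` is proper when `A` is of finite type over `𝒜 0` (Mathlib
  `Mathlib.AlgebraicGeometry.ProjectiveSpectrum.Proper`, proved by the valuative criterion as in
  Hartshorne's proof via II Thm. 4.7; no noetherian hypothesis is needed on this route);
* `k → 𝒜 0 = k[x₀, …, x_N]₀` is bijective (the degree-`0` polynomials are the constants), so
  `Spec (𝒜 0) → Spec k` is an isomorphism, in particular proper;
* proper morphisms compose (II Cor. 4.8(b); Mathlib instance).

## Library note (duplicates downstream)

The chain `Literature.AlgebraicGeometry.Motives.finiteType_gradeZero_mvPolynomial`, `Literature.AlgebraicGeometry.Motives.bijective_algebraMap_gradeZero_mvPolynomial`,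
`Literature.AlgebraicGeometry.Motives.isIso_specMap_gradeZero_mvPolynomial`, `Literature.AlgebraicGeometry.Motives.isProper_projectiveSpace` proved here also exists,
under other names and partly as global instances, in the downstream module
`Literature.NumberTheory.Transcendental.Analytification` (which imports `Varieties` and cannot be
imported here): `Literature.NumberTheory.Transcendental.isScalarTower_gradeZero`, `Literature.NumberTheory.Transcendental.algebraMap_homogeneousSubmodule_zero_bijective`,
`Literature.NumberTheory.Transcendental.finiteType_homogeneousSubmodule_zero`, `Literature.NumberTheory.Transcendental.isIso_specMap_algebraMap_homogeneousSubmodule_zero`,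
`Literature.NumberTheory.Transcendental.isProper_projectiveSpace_hom`. The names here are distinct, and the present declarations are
theorems (used via `haveI`), so nothing collides and no instance is overridden; a librarian refactor
should make `Analytification` import this module and delete its five copies.

## References

* R. Hartshorne, *Algebraic Geometry*, GTM 52, Springer (1977), doi:10.1007/978-1-4757-3849-0:
  Ch. II §4, Definition of projective morphisms and Thm. 4.9 (p. 103), Cor. 4.8(a),(b) (p. 102),
  Thm. 4.7 (valuative criterion of properness). [Hartshorne1977]
* The Stacks project, Tag 01WC (projective ⇒ proper). [StacksProject]
-/

universe u

open CategoryTheory AlgebraicGeometry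

namespace Literature.AlgebraicGeometry.Motives

section ProjectiveSpace

variable (n : ℕ) (k : Type u) [Field k]

/-- `k[x₀, …, xₙ]` is of finite type over its degree-zero part `k[x₀, …, xₙ]₀` (it is already of
finite type over `k ⊆ k[x₀, …, xₙ]₀`); this is the hypothesis of Mathlib's properness of
`Proj.toSpecZero`. [folklore] -/
theorem finiteType_gradeZero_mvPolynomial :
    letI := MvPolynomial.gradedAlgebra (σ := Fin (n + 1)) (R := k)
    Algebra.FiniteType (MvPolynomial.homogeneousSubmodule (Fin (n + 1)) k 0)
      (MvPolynomial (Fin (n + 1)) k) := by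
  letI := MvPolynomial.gradedAlgebra (σ := Fin (n + 1)) (R := k)
  haveI : IsScalarTower k (MvPolynomial.homogeneousSubmodule (Fin (n + 1)) k 0)
      (MvPolynomial (Fin (n + 1)) k) :=
    IsScalarTower.of_algebraMap_eq (R := k)
      (S := MvPolynomial.homogeneousSubmodule (Fin (n + 1)) k 0)
      (A := MvPolynomial (Fin (n + 1)) k) (fun _ => rfl)
  exact Algebra.FiniteType.of_restrictScalars_finiteType k _ _

/-- The degree-zero part of `k[x₀, …, xₙ]` is `k`: `k → k[x₀, …, xₙ]₀` is bijective (a polynomial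
homogeneous of degree `0` is a constant; Hartshorne II Prop. 2.5 setting, `S₀ = A`). [folklore] -/
theorem bijective_algebraMap_gradeZero_mvPolynomial :
    letI := MvPolynomial.gradedAlgebra (σ := Fin (n + 1)) (R := k)
    Function.Bijective
      (algebraMap k (MvPolynomial.homogeneousSubmodule (Fin (n + 1)) k 0)) := by
  letI := MvPolynomial.gradedAlgebra (σ := Fin (n + 1)) (R := k)
  constructor
  · intro a b h
    have := congrArg Subtype.val h
    simpa using this
  · rintro ⟨p, hp⟩
    rw [MvPolynomial.mem_homogeneousSubmodule, ← MvPolynomial.totalDegree_zero_iff_isHomogeneous,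
      MvPolynomial.totalDegree_eq_zero_iff_eq_C] at hp
    refine ⟨MvPolynomial.coeff 0 p, Subtype.ext ?_⟩
    rw [SetLike.GradeZero.coe_algebraMap, MvPolynomial.algebraMap_eq]
    exact hp.symm

/-- `Spec k[x₀, …, xₙ]₀ → Spec k` is an isomorphism (`Spec` of a bijective ring map). [folklore] -/
theorem isIso_specMap_gradeZero_mvPolynomial :
    letI := MvPolynomial.gradedAlgebra (σ := Fin (n + 1)) (R := k)
    IsIso (Spec.map (CommRingCat.ofHom
      (algebraMap k (MvPolynomial.homogeneousSubmodule (Fin (n + 1)) k 0)))) := by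
  letI := MvPolynomial.gradedAlgebra (σ := Fin (n + 1)) (R := k)
  haveI : IsIso (CommRingCat.ofHom
      (algebraMap k (MvPolynomial.homogeneousSubmodule (Fin (n + 1)) k 0))) :=
    (RingEquiv.ofBijective _
      (bijective_algebraMap_gradeZero_mvPolynomial n k)).toCommRingCatIso.isIso_hom
  infer_instance

/-- Projective space is proper over the base field: `ℙⁿ_k → Spec k` is proper. This is the case
`X = ℙⁿ` to which Hartshorne reduces II Thm. 4.9; here `ℙⁿ_k → Spec k` is
`Proj 𝒜 → Spec (𝒜 0) ≅ Spec k`, and `Proj 𝒜 → Spec (𝒜 0)` is proper by Mathlib's valuative-criterion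
proof (`Mathlib.AlgebraicGeometry.ProjectiveSpectrum.Proper`, cf. II Thm. 4.7).
[cite: Hartshorne1977, Ch. II Thm. 4.9 (p. 103), proof: reduction to ℙⁿ via Thm. 4.7] -/
theorem isProper_projectiveSpace : IsProper (projectiveSpace n k).hom := by
  letI := MvPolynomial.gradedAlgebra (σ := Fin (n + 1)) (R := k)
  haveI := finiteType_gradeZero_mvPolynomial n k
  haveI := isIso_specMap_gradeZero_mvPolynomial n k
  -- `change` (not `rw`) so that the source is syntactically `Proj 𝒜`, as Mathlib's instance expects
  change IsProper (Proj.toSpecZero (MvPolynomial.homogeneousSubmodule (Fin (n + 1)) k) ≫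
    Spec.map (CommRingCat.ofHom
      (algebraMap k (MvPolynomial.homogeneousSubmodule (Fin (n + 1)) k 0))))
  infer_instance

end ProjectiveSpace

section Projective

variable {k : Type u} [Field k] {n : ℕ} {X : SchemeOver k}

/-- **Hartshorne II Thm. 4.9** for `k`-schemes: a projective `k`-scheme is proper over `k`. If
`ι : X ↪ ℙᴺ_k` is a closed `k`-immersion then `X → Spec k` equals `ι ≫ (ℙᴺ_k → Spec k)`
(`Over.w`), a closed immersion is proper (II Cor. 4.8(a)), `ℙᴺ_k → Spec k` is proper
(`Literature.AlgebraicGeometry.Motives.isProper_projectiveSpace`), and a composition of proper morphisms is proper (II Cor. 4.8(b)).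
The noetherian hypothesis of the printed theorem is not needed on this route (and holds anyway for
schemes of finite type over a field).
[cite: Hartshorne1977, Ch. II Thm. 4.9 (p. 103) with Cor. 4.8(a),(b) (p. 102)] -/
theorem IsProjectiveOver.isProper (h : IsProjectiveOver X) : IsProper X.hom := by
  obtain ⟨N, ι, hι⟩ := h
  haveI := isProper_projectiveSpace N k
  rw [← Over.w ι]
  infer_instance

/-- Discharge of the named fact `Literature.AlgebraicGeometry.Motives.IsSmoothProjective.isProper`: the structure morphism of a smooth
projective variety over a field `k` is proper, because `X` is projective over `k`
(`Literature.AlgebraicGeometry.Motives.IsProjectiveOver.isProper`, Hartshorne II Thm. 4.9).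
[cite: Hartshorne1977, Ch. II Thm. 4.9 (p. 103)] -/
theorem IsSmoothProjective.isProper_holds : IsSmoothProjective.isProper (n := n) (X := X) :=
  fun h => h.isProjectiveOver.isProper

end Projective

end Literature.AlgebraicGeometry.Motives
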